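import Summits.Ventures.QEC.Census.CertCoverBatch
import Summits.Ventures.QEC.Census.BB.A1s_n192_k8_4a6ca3c0.L1Iface
import HarnessLib

set_option Elab.async false
set_option maxRecDepth 200000

/-!
# `[[192,8,16]]` one-level cover certificate of `A1s_n192_k8_4a6ca3c0` — WITNESS TABLE round trip, part B: `orbCheckAux ePermqs eTr eInv 48` on representative chunks 3–3
(≤ 80 representatives × 48 translations each; type-12 lockstep `permWordL`; qec-type-10 `CertCoverBatch.orbCheck`). Data (chunk lists) + decided checks; KERNEL. qec-search-1 g5.
-/

namespace Summit.Ventures.QEC.Census.A1s_n192_k8_4a6ca3c0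

open Matrix Summit.Ventures.QEC.Census Literature.InformationTheory.QuantumCodes

/-- Representatives 240–268. -/
def repsC3 : List ℕ :=
  [
    0x881084324000010006104, 0x881102208100000780048, 0x883102204100002680040, 0x899084320200000006100,
    0x8c1084004000011006320, 0x903102244100100680000, 0x983803040040900802000, 0xc01087224000080004140,
    0x1001006006001001084084, 0x100100c806000041088904, 0x10010240818900013c0000, 0x1001048102022101000780,
    0x1003102044101020680008, 0x100380c800040042808900, 0x1011081044001880800380, 0x1401082224001880002180,
    0x1801082024001090002380, 0x1c010812240010800001c0, 0x200504811012000440001c, 0x204104820202000500021a,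
    0x2081019306000001091000, 0x2081048208120080600208, 0x240108822400288000e000, 0x4041018326004000090020,
    0x4061890200a00042400008, 0x4081018306004081090000, 0x4081890404000008800434, 0x4081890450200000400450,
    0x4101890410200102400410]

set_option maxHeartbeats 400000000 in
/-- Round trip on chunk 3 (29 representatives × 48 translations). -/
theorem orbChk3 : orbCheckAux A1s_n192_k8_4a6ca3c0.ePermqs eTr eInv 48 repsC3 = true := by decide +kernel


end Summit.Ventures.QEC.Census.A1s_n192_k8_4a6ca3c0
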